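import Summits.QuantumFields.BalabanUV.Beta.GAN24.PeriodicKKTResponseFlux

/-!
# `BalabanUV.Beta.GAN24.PeriodicKKTExchangePairing` — binder row G-an2-4 ∕ (CONV-C), W-slot CT-W, conservation law (C)∕(C)sym: **THE EXCHANGE PAIRING OF TWO
# BLOCK-PERIODIC CURRENTS THROUGH THE `U = 1` KKT RESOLVENT — `|box|·⟨J′, Γ_N·J⟩_cell = −¼·Σ_{κl}(Σ_cell F′)(Σ_cell F) + ¼·|box|·Σ_cell F′·F` for
# `J = −½·curvAdj F`, `J′ = −½·curvAdj F′`, AND ITS VALUE ON TWO PLAQUETTE COLUMNS `p ⊗ q`, `p′ ⊗ q′`: in-plane only, sign by orientation,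
# `E·(−½·P′P + ½·|box|·Σ_cell p′q′pq)`** (step (P4) of this lineage's note `HOME/b2b-balaban-gan24-formalise-leaf-04/g64/CSYM-D3-ANATOMY.md` §8; generic `d`,
# every block factor `N ≥ 1`, all `N`-periodic profiles)

NOT IN PRINT; OUR BOOKKEEPING ([folklore] finite cell algebra BY NAME over this lineage's `GAN24.PeriodicKKTResponseFlux.card_mul_curv_resp_add_half_eq` (the resolvent
flux identity `curv (Γ·J) = ½(avg F − F)`), `GAN24.PeriodicCellPairing.sum_box_curvAdj_mul` (`curvAdj ⊣ curv` on cell sums) and `GAN24.PeriodicKKTResponse.respA_periodic`;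
G-an2-4 formalisation swarm, leaf prover `b2b-balaban-gan24-formalise-leaf-04`, gen 65).  HONEST FRAMING (cell contract, verbatim): «discharging `BetaPertH` makes Bałaban's
UV stability UNCONDITIONAL — a real constructive-QFT result; it is NOT the continuum limit and NOT the Clay problem.»  HONEST DEPENDENCY (verbatim): «continuum YM on T⁴ ⇐
BetaPertH ∧ nine spine estimates (0/9 proved); BetaPertH ⇐ (D1) ∧ (D4) ∧ CAP+tail; G-an2-4 gates asym, D1 and NE2/3/4.»

WHY (note §3 (c)–(d), §7 (7a)): at level 0 the dressed one-step zero mode differs from the undressed one by the quartic CONTACT excess `(Lc² − 1)·uτ` and by the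
cubic × cubic Wilson EXCHANGE `Σ_sym tLᵀ K tR`; the half-vertices `tL ∕ tR` are edge currents `∓cE·(sL)²·(−½·curvAdj (p ⊗ q))` of exit-face profiles
(`GAN24.WilsonEdgeCurrent`, `GAN24.PeriodicCellPairing.edgeCurrent_eq_neg_half_curvAdj`), and `K`'s field block at level 0 is `Γ_{Lc}`.  THIS FILE is the
number `⟨J′, Γ·J⟩_cell`: for exit-face indicators (`Σ p = Σ p² = 1` per period) and `|box| = N^{d+1}` it reads `±½(1 − N⁻²)·N^{d−1}` in-plane and `0` across
planes — the located law «exchange = −(Lc² − 1) × undressed quartic contact» once the pins `cE₂ = cE²`, `s = Lc^{−(d+2)}` are inserted (ENGINE-indicated at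
d+1 = 2, 3, 4, Lc = 3, 5, 9: kit j167031 ∕ j168341 ∕ j168345 ∕ j169947).  The bracket bookkeeping that places this number inside `zmode (T̃_1) − zmode (T_1)` is
step (P5), not here.

WHAT ([folklore]; 0 `def`, 0 cited facts, 0 `def … : Prop`, 0 sorry): §1 **`card_mul_pairing_eq`** (general block-periodic `F` antisymmetric closed, `F′` periodic);
§2 plaquette columns `F κ l x = [κ = γ][l = α]·p(x_γ)q(x_α) − [κ = α][l = γ]·p(x_γ)q(x_α)`: `plaq_periodic`, `plaq_antisymm`, `plaq_closed`, `plaq_eq_coef_mul`,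
`sum_box_plaq`, **`sum_coef_mul_coef`** (`Σ_{κl} c′c = 2·([γ′ = γ][α′ = α] − [γ′ = α][α′ = γ])`), `sum_plaq_mul_plaq`, **`sum_box_mul_coord`** (`Σ_{r ∈ box} f(r_γ)g(r_α) =
N^{d−1}·(Σ_{t<N} f)(Σ_{t<N} g)`, `γ ≠ α`); §3 **`card_mul_pairing_plaq`**.  Asserts NO value of Bałaban's tables; discharges NOTHING of (C)sym ∕ (Q-D) ∕ (Q-D-rate) ∕
«T2Shape» ∕ «T2Drift» ∕ (hW, hWall); NEVER «G-an2-4 closed» as (CONV-C); NOT D1, NOT `BetaPertH`, NOT continuum, NOT Clay.  2026-08-22; no existing file touched.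
-/

noncomputable section

open Finset
open scoped BigOperators
open Literature.MathematicalPhysics.QuantumFieldTheory
open Literature.MathematicalPhysics.QuantumFieldTheory.Balaban1983to89.Beta
open AffineAveraging (Form0 Form1 Form2 unitVec dz curv curvAdj codiff₁ box toSite)
open KKTFluctuationKernel (Gam)
open PeriodicDescent (IsPeriodic)
open Summit.QuantumFields.BalabanUV.Beta.GAN24.PeriodicKKTResponse (respA_periodic)
open Summit.QuantumFields.BalabanUV.Beta.GAN24.PeriodicKKTResponseFlux (current_periodic card_mul_curv_resp_add_half_eq)
open Summit.QuantumFields.BalabanUV.Beta.GAN24.PeriodicCellPairing (sum_box_curvAdj_mul)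

namespace Summit.QuantumFields.BalabanUV.Beta.GAN24.PeriodicKKTExchangePairing

variable {d N : ℕ} [NeZero N]

/-! ## §1 The cell pairing of a current with the resolvent response to another current -/

/-- [folklore] **THE EXCHANGE PAIRING THROUGH THE `U = 1` KKT RESOLVENT, GENERAL FORM**: for block-periodic 2-forms `F` (antisymmetric, closed) and `F′`, the
cell pairing of the current `J′ = −½·curvAdj F′` with the resolvent response `A = Γ_N·(−½·curvAdj F)` is
`|box|·Σ_{x ∈ cell} Σ_μ J′ μ x·A μ x = −¼·Σ_{κl} (Σ_cell F′ κ l)(Σ_cell F κ l) + ¼·|box|·Σ_{x ∈ cell} Σ_{κl} F′ κ l x·F κ l x`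
(`PeriodicCellPairing.sum_box_curvAdj_mul`: the pairing is `−½·Σ_cell F′·curv A`; insert the flux identity `PeriodicKKTResponseFlux.card_mul_curv_resp_add_half_eq`). -/
theorem card_mul_pairing_eq {F F' : Form2 (d + 1) ℝ} (hF : ∀ κ l, IsPeriodic N (F κ l)) (hFa : ∀ κ l x, F κ l x = -F l κ x)
    (hFcl : ∀ (κ l m : Fin (d + 1)) (x : AffineAveraging.Site (d + 1)),
      (F l m (x + unitVec κ) - F l m x) + (F m κ (x + unitVec l) - F m κ x) + (F κ l (x + unitVec m) - F κ l x) = 0)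
    (hF' : ∀ κ l, IsPeriodic N (F' κ l)) :
    ((box (d + 1) N).card : ℝ) * ∑ r ∈ box (d + 1) N, ∑ μ, (-(1 / 2 : ℝ) * curvAdj F' μ (toSite r)) *
        (∑' y, ∑ l, (-(1 / 2 : ℝ) * curvAdj F l y) * Gam (N := N) μ (toSite r) l y) =
      -(1 / 4 : ℝ) * ∑ κ, ∑ l, (∑ r ∈ box (d + 1) N, F' κ l (toSite r)) * (∑ r ∈ box (d + 1) N, F κ l (toSite r))
        + (1 / 4 : ℝ) * ((box (d + 1) N).card : ℝ) * ∑ r ∈ box (d + 1) N, ∑ κ, ∑ l, F' κ l (toSite r) * F κ l (toSite r) := by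
  set A : Form1 (d + 1) ℝ := fun κ x => ∑' y, ∑ l, (-(1 / 2 : ℝ) * curvAdj F l y) * Gam (N := N) κ x l y with hAdef
  have hJp : ∀ l y t, -(1 / 2 : ℝ) * curvAdj F l (y + (N : ℤ) • t) = -(1 / 2 : ℝ) * curvAdj F l y := current_periodic (N := N) hF
  have hA : ∀ κ, IsPeriodic N (A κ) := fun κ x a =>
    respA_periodic (N := N) (J := fun l y => -(1 / 2 : ℝ) * curvAdj F l y) hJp κ x a
  have hflux : ∀ κ l x, ((box (d + 1) N).card : ℝ) * curv A κ l x =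
      (1 / 2 : ℝ) * ∑ r ∈ box (d + 1) N, F κ l (toSite r) - (1 / 2 : ℝ) * ((box (d + 1) N).card : ℝ) * F κ l x := by
    intro κ l x
    have h := card_mul_curv_resp_add_half_eq (N := N) hF hFa hFcl κ l x
    rw [mul_add] at h
    linarith
  -- the pairing is `−½·Σ_cell F′·curv A`
  have hpair : ∑ r ∈ box (d + 1) N, ∑ μ, (-(1 / 2 : ℝ) * curvAdj F' μ (toSite r)) * A μ (toSite r) =
      -(1 / 2 : ℝ) * ∑ r ∈ box (d + 1) N, ∑ κ, ∑ l, F' κ l (toSite r) * curv A κ l (toSite r) := by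
    rw [← sum_box_curvAdj_mul (N := N) hF' hA, Finset.mul_sum]
    refine Finset.sum_congr rfl fun r _ => ?_
    rw [Finset.mul_sum]
    exact Finset.sum_congr rfl fun μ _ => by ring
  show ((box (d + 1) N).card : ℝ) * ∑ r ∈ box (d + 1) N, ∑ μ, (-(1 / 2 : ℝ) * curvAdj F' μ (toSite r)) * A μ (toSite r) = _
  rw [hpair]
  have e : ∀ r ∈ box (d + 1) N, ((box (d + 1) N).card : ℝ) * ∑ κ, ∑ l, F' κ l (toSite r) * curv A κ l (toSite r) =
      ∑ κ, ∑ l, F' κ l (toSite r) * ((1 / 2 : ℝ) * ∑ r' ∈ box (d + 1) N, F κ l (toSite r') - (1 / 2 : ℝ) * ((box (d + 1) N).card : ℝ) * F κ l (toSite r)) := by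
    intro r _
    rw [Finset.mul_sum]
    refine Finset.sum_congr rfl fun κ _ => ?_
    rw [Finset.mul_sum]
    refine Finset.sum_congr rfl fun l _ => ?_
    rw [← hflux κ l (toSite r)]
    ring
  set c : ℝ := ((box (d + 1) N).card : ℝ) with hc
  set S : Fin (d + 1) → Fin (d + 1) → ℝ := fun κ l => ∑ r' ∈ box (d + 1) N, F κ l (toSite r') with hS
  have step1 : c * (-(1 / 2 : ℝ) * ∑ r ∈ box (d + 1) N, ∑ κ, ∑ l, F' κ l (toSite r) * curv A κ l (toSite r)) =
      -(1 / 2 : ℝ) * ∑ r ∈ box (d + 1) N, c * ∑ κ, ∑ l, F' κ l (toSite r) * curv A κ l (toSite r) := by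
    rw [← Finset.mul_sum]
    ring
  rw [step1, Finset.sum_congr rfl e]
  have split : ∀ r : Fin (d + 1) → ℕ, ∑ κ, ∑ l, F' κ l (toSite r) * ((1 / 2 : ℝ) * S κ l - (1 / 2 : ℝ) * c * F κ l (toSite r)) =
      (1 / 2 : ℝ) * (∑ κ, ∑ l, F' κ l (toSite r) * S κ l) - (1 / 2 : ℝ) * c * (∑ κ, ∑ l, F' κ l (toSite r) * F κ l (toSite r)) := by
    intro r
    rw [Finset.mul_sum, Finset.mul_sum, ← Finset.sum_sub_distrib]
    refine Finset.sum_congr rfl fun κ _ => ?_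
    rw [Finset.mul_sum, Finset.mul_sum, ← Finset.sum_sub_distrib]
    refine Finset.sum_congr rfl fun l _ => ?_
    ring
  rw [Finset.sum_congr rfl (fun r _ => split r), Finset.sum_sub_distrib, ← Finset.mul_sum, ← Finset.mul_sum]
  have hSS : ∑ r ∈ box (d + 1) N, ∑ κ, ∑ l, F' κ l (toSite r) * S κ l = ∑ κ, ∑ l, (∑ r ∈ box (d + 1) N, F' κ l (toSite r)) * S κ l := by
    rw [Finset.sum_comm]
    refine Finset.sum_congr rfl fun κ _ => ?_
    rw [Finset.sum_comm]
    refine Finset.sum_congr rfl fun l _ => ?_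
    rw [Finset.sum_mul]
  rw [hSS]
  ring

/-! ## §2 Plaquette columns `p ⊗ q`: periodicity, antisymmetry, closedness, cell sums -/

section Plaquette

variable {γ α : Fin (d + 1)}

omit [NeZero N] in
/-- [folklore] The plaquette-column 2-form `F κ l x = [κ = γ][l = α]·p(x_γ)q(x_α) − [κ = α][l = γ]·p(x_γ)q(x_α)` of `N`-periodic profiles `p q` is block-periodic. -/
theorem plaq_periodic (p q : ℤ → ℝ) (hp : ∀ t (k : ℤ), p (t + (N : ℤ) * k) = p t) (hq : ∀ t (k : ℤ), q (t + (N : ℤ) * k) = q t)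
    (κ l : Fin (d + 1)) :
    IsPeriodic N (fun x : AffineAveraging.Site (d + 1) =>
      (if κ = γ ∧ l = α then p (x γ) * q (x α) else 0) - (if κ = α ∧ l = γ then p (x γ) * q (x α) else 0)) := by
  intro x a
  simp only [Pi.add_apply, Pi.smul_apply, smul_eq_mul, hp, hq]

omit [NeZero N] in
/-- [folklore] The plaquette column is antisymmetric. -/
theorem plaq_antisymm (p q : ℤ → ℝ) (κ l : Fin (d + 1)) (x : AffineAveraging.Site (d + 1)) :
    ((if κ = γ ∧ l = α then p (x γ) * q (x α) else 0) - (if κ = α ∧ l = γ then p (x γ) * q (x α) else 0)) =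
      -((if l = γ ∧ κ = α then p (x γ) * q (x α) else 0) - (if l = α ∧ κ = γ then p (x γ) * q (x α) else 0)) := by
  split_ifs <;> first | (exfalso; tauto) | ring

omit [NeZero N] in
/-- [folklore] The plaquette column is closed (it depends on the two in-plane coordinates only; cyclic sum of the three differences). -/
theorem plaq_closed (p q : ℤ → ℝ) (κ l m : Fin (d + 1)) (x : AffineAveraging.Site (d + 1)) :
    (((if l = γ ∧ m = α then p ((x + unitVec κ) γ) * q ((x + unitVec κ) α) else 0) - (if l = α ∧ m = γ then p ((x + unitVec κ) γ) * q ((x + unitVec κ) α) else 0))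
        - ((if l = γ ∧ m = α then p (x γ) * q (x α) else 0) - (if l = α ∧ m = γ then p (x γ) * q (x α) else 0)))
      + (((if m = γ ∧ κ = α then p ((x + unitVec l) γ) * q ((x + unitVec l) α) else 0) - (if m = α ∧ κ = γ then p ((x + unitVec l) γ) * q ((x + unitVec l) α) else 0))
        - ((if m = γ ∧ κ = α then p (x γ) * q (x α) else 0) - (if m = α ∧ κ = γ then p (x γ) * q (x α) else 0)))
      + (((if κ = γ ∧ l = α then p ((x + unitVec m) γ) * q ((x + unitVec m) α) else 0) - (if κ = α ∧ l = γ then p ((x + unitVec m) γ) * q ((x + unitVec m) α) else 0))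
        - ((if κ = γ ∧ l = α then p (x γ) * q (x α) else 0) - (if κ = α ∧ l = γ then p (x γ) * q (x α) else 0))) = 0 := by
  -- write `F κ l y = c κ l · f y` and use: `f (x + e_ν) = f x` unless `ν ∈ {γ, α}`
  have hf : ∀ ν : Fin (d + 1), ν ≠ γ → ν ≠ α → p ((x + unitVec ν) γ) * q ((x + unitVec ν) α) = p (x γ) * q (x α) := by
    intro ν hνγ hνα
    simp [unitVec, Ne.symm hνγ, Ne.symm hνα]
  by_cases hκγ : κ = γ <;> by_cases hκα : κ = α <;> by_cases hlγ : l = γ <;> by_cases hlα : l = α <;>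
    by_cases hmγ : m = γ <;> by_cases hmα : m = α <;>
    simp only [hκγ, hκα, hlγ, hlα, hmγ, hmα, and_true, and_false, true_and, false_and, if_true, if_false,
      sub_self, add_zero, zero_add] <;>
    (try subst_vars) <;> (try simp_all)

omit [NeZero N] in
/-- [folklore] The plaquette column is a Kronecker coefficient times the profile product: `F κ l x = c κ l·p(x_γ)q(x_α)`. -/
theorem plaq_eq_coef_mul (p q : ℤ → ℝ) (κ l : Fin (d + 1)) (x : AffineAveraging.Site (d + 1)) :
    ((if κ = γ ∧ l = α then p (x γ) * q (x α) else 0) - (if κ = α ∧ l = γ then p (x γ) * q (x α) else 0)) =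
      ((if κ = γ ∧ l = α then (1 : ℝ) else 0) - (if κ = α ∧ l = γ then (1 : ℝ) else 0)) * (p (x γ) * q (x α)) := by
  split_ifs <;> ring

omit [NeZero N] in
/-- [folklore] **CELL SUMS OF A PLAQUETTE COLUMN**: `Σ_{r ∈ box} F κ l (toSite r) = c κ l·Σ_{r ∈ box} p(r_γ)q(r_α)`. -/
theorem sum_box_plaq (p q : ℤ → ℝ) (κ l : Fin (d + 1)) :
    ∑ r ∈ box (d + 1) N, ((if κ = γ ∧ l = α then p (toSite r γ) * q (toSite r α) else 0) -
        (if κ = α ∧ l = γ then p (toSite r γ) * q (toSite r α) else 0)) =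
      ((if κ = γ ∧ l = α then (1 : ℝ) else 0) - (if κ = α ∧ l = γ then (1 : ℝ) else 0)) *
        ∑ r ∈ box (d + 1) N, p (toSite r γ) * q (toSite r α) := by
  rw [Finset.mul_sum]
  exact Finset.sum_congr rfl fun r _ => plaq_eq_coef_mul p q κ l (toSite r)

omit [NeZero N] in
/-- [folklore] **THE KRONECKER CONTRACTION OF TWO PLAQUETTE-COLUMN COEFFICIENTS**: `Σ_{κl} c′ κ l·c κ l = 2·([γ′ = γ][α′ = α] − [γ′ = α][α′ = γ])`. -/
theorem sum_coef_mul_coef (γ α γ' α' : Fin (d + 1)) :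
    ∑ κ : Fin (d + 1), ∑ l : Fin (d + 1), ((if κ = γ' ∧ l = α' then (1 : ℝ) else 0) - (if κ = α' ∧ l = γ' then (1 : ℝ) else 0)) *
        ((if κ = γ ∧ l = α then (1 : ℝ) else 0) - (if κ = α ∧ l = γ then (1 : ℝ) else 0)) =
      2 * ((if γ' = γ ∧ α' = α then (1 : ℝ) else 0) - (if γ' = α ∧ α' = γ then (1 : ℝ) else 0)) := by
  have key : ∀ (a b : Fin (d + 1)) (X : Fin (d + 1) → Fin (d + 1) → ℝ),
      ∑ κ, ∑ l, (if κ = a ∧ l = b then X κ l else 0) = X a b := by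
    intro a b X
    rw [Finset.sum_eq_single_of_mem a (Finset.mem_univ a) (fun κ _ hκ => Finset.sum_eq_zero fun l _ => by simp [hκ]),
      Finset.sum_eq_single_of_mem b (Finset.mem_univ b) (fun l _ hl => by simp [hl])]
    simp
  have e : ∀ κ l : Fin (d + 1), ((if κ = γ' ∧ l = α' then (1 : ℝ) else 0) - (if κ = α' ∧ l = γ' then (1 : ℝ) else 0)) *
      ((if κ = γ ∧ l = α then (1 : ℝ) else 0) - (if κ = α ∧ l = γ then (1 : ℝ) else 0)) =
      (if κ = γ' ∧ l = α' then ((if κ = γ ∧ l = α then (1 : ℝ) else 0) - (if κ = α ∧ l = γ then (1 : ℝ) else 0)) else 0) -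
        (if κ = α' ∧ l = γ' then ((if κ = γ ∧ l = α then (1 : ℝ) else 0) - (if κ = α ∧ l = γ then (1 : ℝ) else 0)) else 0) := by
    intro κ l
    split_ifs <;> ring
  simp_rw [e]
  rw [Finset.sum_congr rfl fun κ _ => Finset.sum_sub_distrib (s := Finset.univ)
      (f := fun l => if κ = γ' ∧ l = α' then ((if κ = γ ∧ l = α then (1 : ℝ) else 0) - (if κ = α ∧ l = γ then (1 : ℝ) else 0)) else 0)
      (g := fun l => if κ = α' ∧ l = γ' then ((if κ = γ ∧ l = α then (1 : ℝ) else 0) - (if κ = α ∧ l = γ then (1 : ℝ) else 0)) else 0),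
    Finset.sum_sub_distrib, key γ' α', key α' γ']
  split_ifs <;> first | (exfalso; tauto) | norm_num

omit [NeZero N] in
/-- [folklore] **THE POINTWISE CONTRACTION OF TWO PLAQUETTE COLUMNS**: `Σ_{κl} F′ κ l x·F κ l x = 2·([γ′ = γ][α′ = α] − [γ′ = α][α′ = γ])·p′(x_{γ′})q′(x_{α′})p(x_γ)q(x_α)`. -/
theorem sum_plaq_mul_plaq {γ' α' : Fin (d + 1)} (p q p' q' : ℤ → ℝ) (x : AffineAveraging.Site (d + 1)) :
    ∑ κ : Fin (d + 1), ∑ l : Fin (d + 1),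
        ((if κ = γ' ∧ l = α' then p' (x γ') * q' (x α') else 0) - (if κ = α' ∧ l = γ' then p' (x γ') * q' (x α') else 0)) *
        ((if κ = γ ∧ l = α then p (x γ) * q (x α) else 0) - (if κ = α ∧ l = γ then p (x γ) * q (x α) else 0)) =
      2 * ((if γ' = γ ∧ α' = α then (1 : ℝ) else 0) - (if γ' = α ∧ α' = γ then (1 : ℝ) else 0)) *
        (p' (x γ') * q' (x α') * (p (x γ) * q (x α))) := by
  simp_rw [plaq_eq_coef_mul]
  have e : ∀ κ l : Fin (d + 1),
      ((if κ = γ' ∧ l = α' then (1 : ℝ) else 0) - (if κ = α' ∧ l = γ' then (1 : ℝ) else 0)) * (p' (x γ') * q' (x α')) *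
        (((if κ = γ ∧ l = α then (1 : ℝ) else 0) - (if κ = α ∧ l = γ then (1 : ℝ) else 0)) * (p (x γ) * q (x α))) =
      ((if κ = γ' ∧ l = α' then (1 : ℝ) else 0) - (if κ = α' ∧ l = γ' then (1 : ℝ) else 0)) *
        ((if κ = γ ∧ l = α then (1 : ℝ) else 0) - (if κ = α ∧ l = γ then (1 : ℝ) else 0)) * (p' (x γ') * q' (x α') * (p (x γ) * q (x α))) := by
    intro κ l; ring
  simp_rw [e]
  rw [Finset.sum_congr rfl fun κ _ => (Finset.sum_mul (s := Finset.univ) _ _).symm, ← Finset.sum_mul, sum_coef_mul_coef]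

omit [NeZero N] in
/-- [folklore] **COORDINATE FACTORISATION OF A CELL SUM** (`γ ≠ α`): `Σ_{r ∈ box} f(r_γ)·g(r_α) = N^{d−1}·(Σ_{t<N} f t)·(Σ_{t<N} g t)`. -/
theorem sum_box_mul_coord (hγα : γ ≠ α) (f g : ℤ → ℝ) :
    ∑ r ∈ box (d + 1) N, f (toSite r γ) * g (toSite r α) =
      (N : ℝ) ^ (d - 1) * (∑ t ∈ Finset.range N, f t) * (∑ t ∈ Finset.range N, g t) := by
  classical
  set h : Fin (d + 1) → ℕ → ℝ := fun i n => if i = γ then f n else if i = α then g n else 1 with hh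
  have hprod : ∀ r : Fin (d + 1) → ℕ, f (toSite r γ) * g (toSite r α) = ∏ i, h i (r i) := by
    intro r
    have h1 : ∏ i ∈ (Finset.univ.erase γ).erase α, h i (r i) = 1 := Finset.prod_eq_one fun i hi => by
      simp only [Finset.mem_erase] at hi
      simp [h, hi.1, hi.2.1]
    rw [← Finset.mul_prod_erase _ _ (Finset.mem_univ γ),
      ← Finset.mul_prod_erase _ _ (Finset.mem_erase.2 ⟨Ne.symm hγα, Finset.mem_univ α⟩), h1]
    simp [h, Ne.symm hγα, toSite]
  simp_rw [hprod]
  rw [show box (d + 1) N = Fintype.piFinset (fun _ => Finset.range N) from rfl, Finset.sum_prod_piFinset]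
  have h2 : ∏ i ∈ (Finset.univ.erase γ).erase α, ∑ n ∈ Finset.range N, h i n = (N : ℝ) ^ (d - 1) := by
    rw [Finset.prod_congr rfl fun i hi => by
      simp only [Finset.mem_erase] at hi
      show ∑ n ∈ Finset.range N, h i n = (N : ℝ)
      simp [h, hi.1, hi.2.1]]
    rw [Finset.prod_const, Finset.card_erase_of_mem (Finset.mem_erase.2 ⟨Ne.symm hγα, Finset.mem_univ α⟩),
      Finset.card_erase_of_mem (Finset.mem_univ γ), Finset.card_univ, Fintype.card_fin]
    rfl
  rw [← Finset.mul_prod_erase _ _ (Finset.mem_univ γ),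
    ← Finset.mul_prod_erase _ _ (Finset.mem_erase.2 ⟨Ne.symm hγα, Finset.mem_univ α⟩), h2]
  simp only [h, if_true, Ne.symm hγα, if_false]
  ring

/-! ## §3 The exchange pairing of two plaquette-column currents -/

/-- [folklore] **THE EXCHANGE PAIRING OF TWO EDGE CURRENTS THROUGH THE `U = 1` KKT RESOLVENT** (note §3 (c)–(d): the number behind «exchange = −(Lc² − 1) ×
contact»; generic `d`, every `N ≥ 1`, ALL `N`-periodic profiles): for the plaquette columns `F = p ⊗ q` on `(γ, α)` and `F′ = p′ ⊗ q′` on `(γ′, α′)` (`γ ≠ α`),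
the currents `J = −½·curvAdj F`, `J′ = −½·curvAdj F′` and the resolvent response `A = Γ_N·J`:
`|box|·Σ_{x ∈ cell} Σ_μ J′ μ x·A μ x = ([γ′ = γ][α′ = α] − [γ′ = α][α′ = γ])·(−½·P′·P + ½·|box|·Σ_{x ∈ cell} p′(x_{γ′})q′(x_{α′})p(x_γ)q(x_α))`,
`P := Σ_cell p(x_γ)q(x_α)`, `P′ := Σ_cell p′(x_{γ′})q′(x_{α′})` — IN-PLANE ONLY (zero across planes), sign by relative orientation. -/
theorem card_mul_pairing_plaq (hγα : γ ≠ α) {γ' α' : Fin (d + 1)} (p q p' q' : ℤ → ℝ)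
    (hp : ∀ t (k : ℤ), p (t + (N : ℤ) * k) = p t) (hq : ∀ t (k : ℤ), q (t + (N : ℤ) * k) = q t)
    (hp' : ∀ t (k : ℤ), p' (t + (N : ℤ) * k) = p' t) (hq' : ∀ t (k : ℤ), q' (t + (N : ℤ) * k) = q' t) :
    ((box (d + 1) N).card : ℝ) * ∑ r ∈ box (d + 1) N, ∑ μ,
        (-(1 / 2 : ℝ) * curvAdj (fun κ l (x : AffineAveraging.Site (d + 1)) =>
          (if κ = γ' ∧ l = α' then p' (x γ') * q' (x α') else 0) - (if κ = α' ∧ l = γ' then p' (x γ') * q' (x α') else 0)) μ (toSite r)) *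
        (∑' y, ∑ l, (-(1 / 2 : ℝ) * curvAdj (fun κ l (x : AffineAveraging.Site (d + 1)) =>
          (if κ = γ ∧ l = α then p (x γ) * q (x α) else 0) - (if κ = α ∧ l = γ then p (x γ) * q (x α) else 0)) l y) *
          Gam (N := N) μ (toSite r) l y) =
      ((if γ' = γ ∧ α' = α then (1 : ℝ) else 0) - (if γ' = α ∧ α' = γ then (1 : ℝ) else 0)) *
        (-(1 / 2 : ℝ) * (∑ r ∈ box (d + 1) N, p' (toSite r γ') * q' (toSite r α')) * (∑ r ∈ box (d + 1) N, p (toSite r γ) * q (toSite r α))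
          + (1 / 2 : ℝ) * ((box (d + 1) N).card : ℝ) *
            ∑ r ∈ box (d + 1) N, p' (toSite r γ') * q' (toSite r α') * (p (toSite r γ) * q (toSite r α))) := by
  rw [card_mul_pairing_eq (N := N) (plaq_periodic (N := N) p q hp hq) (plaq_antisymm p q) (plaq_closed (γ := γ) (α := α) p q)
    (plaq_periodic (N := N) p' q' hp' hq')]
  simp_rw [sum_box_plaq (N := N), sum_plaq_mul_plaq (γ := γ) (α := α)]
  have e1 : ∀ κ l : Fin (d + 1),
      ((if κ = γ' ∧ l = α' then (1 : ℝ) else 0) - (if κ = α' ∧ l = γ' then (1 : ℝ) else 0)) * (∑ r ∈ box (d + 1) N, p' (toSite r γ') * q' (toSite r α')) *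
        (((if κ = γ ∧ l = α then (1 : ℝ) else 0) - (if κ = α ∧ l = γ then (1 : ℝ) else 0)) * ∑ r ∈ box (d + 1) N, p (toSite r γ) * q (toSite r α)) =
      ((if κ = γ' ∧ l = α' then (1 : ℝ) else 0) - (if κ = α' ∧ l = γ' then (1 : ℝ) else 0)) *
        ((if κ = γ ∧ l = α then (1 : ℝ) else 0) - (if κ = α ∧ l = γ then (1 : ℝ) else 0)) *
        ((∑ r ∈ box (d + 1) N, p' (toSite r γ') * q' (toSite r α')) * ∑ r ∈ box (d + 1) N, p (toSite r γ) * q (toSite r α)) := by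
    intro κ l; ring
  simp_rw [e1]
  rw [Finset.sum_congr rfl fun κ _ => (Finset.sum_mul (s := Finset.univ) _ _).symm, ← Finset.sum_mul, sum_coef_mul_coef,
    ← Finset.mul_sum]
  have _h := hγα
  ring

end Plaquette

end Summit.QuantumFields.BalabanUV.Beta.GAN24.PeriodicKKTExchangePairing

end
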